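import Mathlib
import Literature.Computability.Complexity.RangeAvoidance
import Literature.Computability.Complexity.SignDegreeXor
import Summits.PneNP.PneNP.Theorems.PstarIsolation
import Summits.PneNP.PneNP.Theorems.PstarIsolationBound
import Summits.PneNP.PneNP.Theorems.PstarIsolationFP

/-!
# Isolation of the all-ones range point of a pure `P⋆` local map — the robust promise (K2⁺) and its FP rung

FRONTIER range-avoidance ladder, rung F-N3(ψ) (cell `pnp-ideate`, ROUND-19, mechanism M19; restricted-model algorithmics —
nothing here bears on `P` vs `NP`).

The landed promise `PstarIsolationBound.PseudoRandom η κ` asks for near-regular XOR volumes AND near-regular AND volumes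
separately; a random SLOT-regular instance (every variable in exactly `4C` slots, slot types random) has per-vertex
XOR/AND imbalance of order `√(C log n)` and eventually violates it for fixed `η`.  The flip inequality needs balance only in
AGGREGATE: `6·volA − 5·volL = (volL + volA)/2 − (11/2)·(volL − volA)`.  This file proves isolation under the ROBUST promise
`PseudoRandomW η β κ`: (i) total occurrence `volL(U) + volA(U) ≥ (1−η)·4C·|U|`; (ii) GLOBAL balance `volL(U) − volA(U) ≤ β√C·n`;
(iii) two-sided discrepancy of `eL` and upper discrepancy of `eA`, `eLA`.  Two regimes from the same identity
`|Ψ| = cut_L + touch_A − 2·both`: for `10|U| ≤ 3n` the bound (A) `|Ψ| + 2eL + eA + 2eLA ≥ volL + volA` (`flipInequalityA`,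
a second sixteen-pattern check); for `10|U| > 3n` the landed K1.  Constants: `(η, β, κ) = (1/50, 2, 2)`, `C₀ = 1600`.
The rung `pstarPseudoRandomW_localAvoidLinearFP : LocalAvoidLinearFP 4 PseudoRandomWPstar` uses the same avoider `isoStr`.
-/

set_option linter.dupNamespace false

open Finset Literature.Computability.Complexity
open Summit.PneNP.PneNP.Theorems.PstarIsolation
open Summit.PneNP.PneNP.Theorems.PstarIsolationBound (AllOnesIsolated)
open Summit.PneNP.PneNP.Theorems.PstarIsolationFP (isoStr isPolyTime_isoStr readOut_isoStr)

namespace Summit.PneNP.PneNP.Theorems.PstarIsolationRobust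

variable {n m : ℕ}

/-! ## Bound (A): every touched slot flips unless cancelled inside its output -/

/-- The per-output form of bound (A) (sixteen slot patterns). -/
theorem per_output_A (I : LocalMap 4 n m) (hI : I.IsPure xorAndPred) (U : Finset (Fin n)) (j : Fin m) :
    tL I U j + tA I U j ≤
      (if I.eval (gauge U) j = false then 1 else 0) + 2 * (if tL I U j = 2 then 1 else 0) +
        (if tA I U j = 2 then 1 else 0) + 2 * (tL I U j * tA I U j) := by
  rw [eval_gauge I hI U j]
  unfold tL tA inU
  by_cases h0 : I.vars j 0 ∈ U <;> by_cases h1 : I.vars j 1 ∈ U <;> by_cases h2 : I.vars j 2 ∈ U <;>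
    by_cases h3 : I.vars j 3 ∈ U <;> simp [h0, h1, h2, h3]

/-- **Bound (A)**: `volL(U) + volA(U) ≤ |Ψ(U)| + 2·eL(U) + eA(U) + 2·eLA(U)` (i.e. `|Ψ| ≥ cut_L + touch_A − 2·eLA`). -/
theorem flipInequalityA (I : LocalMap 4 n m) (hI : I.IsPure xorAndPred) (U : Finset (Fin n)) :
    volL I U + volA I U ≤ (flipped I U).card + 2 * eL I U + eA I U + 2 * eLA I U := by
  have hflip : (flipped I U).card = ∑ j, (if I.eval (gauge U) j = false then 1 else 0) := by
    unfold flipped; rw [Finset.card_filter]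
  have heL : eL I U = ∑ j, (if tL I U j = 2 then 1 else 0) := by unfold eL; rw [Finset.card_filter]
  have heA : eA I U = ∑ j, (if tA I U j = 2 then 1 else 0) := by unfold eA; rw [Finset.card_filter]
  calc volL I U + volA I U = ∑ j, (tL I U j + tA I U j) := by unfold volL volA; rw [Finset.sum_add_distrib]
    _ ≤ ∑ j, ((if I.eval (gauge U) j = false then 1 else 0) + 2 * (if tL I U j = 2 then 1 else 0) +
          (if tA I U j = 2 then 1 else 0) + 2 * (tL I U j * tA I U j)) :=
        Finset.sum_le_sum fun j _ => per_output_A I hI U j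
    _ = (flipped I U).card + 2 * eL I U + eA I U + 2 * eLA I U := by
        rw [hflip, heL, heA]; unfold eLA
        rw [Finset.sum_add_distrib, Finset.sum_add_distrib, Finset.sum_add_distrib, Finset.mul_sum, Finset.mul_sum]

/-! ## The robust promise and the isolation theorem -/

/-- **The robust promise `PseudoRandomW η β κ I`** (poly-time checkable; `C = m/n`): for every vertex set `U`,
(i) total occurrence `(1−η)·4C·|U| ≤ volL(U) + volA(U)` (every variable is read `≥ (1−η)4C` times);
(ii) GLOBAL XOR/AND balance `volL(U) − volA(U) ≤ β·√C·n` (implied by `Σ_v |degL v − degA v| ≤ β√C n`; per-vertex imbalance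
may be large); (iii) discrepancy: `|eL(U) − C|U|²/n| ≤ κ√C|U|`, `eA(U) ≤ C|U|²/n + κ√C|U|`, `eLA(U) ≤ 4C|U|²/n + 2κ√C|U|`.
Random slot-regular instances satisfy it for every `n` (with `η = 0`, `β ≈ 1.6`, `κ ≈ 1.45`; not formalised). -/
def PseudoRandomW (η β κ : ℝ) (I : LocalMap 4 n m) : Prop :=
  ∀ U : Finset (Fin n),
    (1 - η) * (4 * ((m : ℝ) / n)) * U.card ≤ (volL I U : ℝ) + volA I U ∧
    (volL I U : ℝ) - volA I U ≤ β * Real.sqrt ((m : ℝ) / n) * n ∧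
    (m : ℝ) / n ^ 2 * (U.card : ℝ) ^ 2 - κ * Real.sqrt ((m : ℝ) / n) * U.card ≤ (eL I U : ℝ) ∧
    (eL I U : ℝ) ≤ (m : ℝ) / n ^ 2 * (U.card : ℝ) ^ 2 + κ * Real.sqrt ((m : ℝ) / n) * U.card ∧
    (eA I U : ℝ) ≤ (m : ℝ) / n ^ 2 * (U.card : ℝ) ^ 2 + κ * Real.sqrt ((m : ℝ) / n) * U.card ∧
    (eLA I U : ℝ) ≤ 4 * ((m : ℝ) / n ^ 2 * (U.card : ℝ) ^ 2) + 2 * κ * Real.sqrt ((m : ℝ) / n) * U.card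

/-- **K2⁺.** Isolation under the robust promise, `C₀ = 1600`. -/
theorem allOnesIsolated_of_pseudoRandomW (I : LocalMap 4 n m) (hI : I.IsPure xorAndPred)
    (hR : PseudoRandomW (1 / 50) 2 2 I) (hn : 0 < n) (hm : 1600 * n ≤ m) : AllOnesIsolated I := by
  intro i hi
  obtain ⟨x, hx⟩ := hi
  set U : Finset (Fin n) := univ.filter fun v => x v = false with hU
  have hcard : (flipped I U).card = 1 := flipped_card_of_preimage I x i hx
  have hne : U.Nonempty := support_nonempty_of_preimage I hI x i hx
  have hu : (1 : ℝ) ≤ U.card := by exact_mod_cast hne.card_pos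
  have hn' : (0 : ℝ) < n := by exact_mod_cast hn
  have hC : (1600 : ℝ) ≤ (m : ℝ) / n := by
    rw [le_div_iff₀ hn']; exact_mod_cast hm
  set s : ℝ := Real.sqrt ((m : ℝ) / n) with hs
  have hs_sq : s ^ 2 = (m : ℝ) / n := Real.sq_sqrt (by positivity)
  have hs0 : 0 ≤ s := Real.sqrt_nonneg _
  have hs40 : 40 ≤ s := by
    have h16 : Real.sqrt 1600 = 40 := by
      rw [show (1600 : ℝ) = 40 ^ 2 by norm_num]; exact Real.sqrt_sq (by norm_num)
    rw [← h16]; exact Real.sqrt_le_sqrt hC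
  have hss : 40 * s ≤ s ^ 2 := by rw [sq]; exact mul_le_mul_of_nonneg_right hs40 hs0
  obtain ⟨hocc, himb, heLlo, heLhi, heA, heLA⟩ := hR U
  -- the two counting inequalities, cast to `ℝ`, with `|Ψ(U)| = 1`
  have hK : (6 * volA I U + 10 * eL I U : ℕ) ≤ 6 * (flipped I U).card + 6 * eA I U + 5 * volL I U + eLA I U :=
    flipInequality n m I hI U
  have hA : volL I U + volA I U ≤ (flipped I U).card + 2 * eL I U + eA I U + 2 * eLA I U := flipInequalityA I hI U
  rw [hcard] at hK hA
  have hK' : 6 * (volA I U : ℝ) + 10 * (eL I U : ℝ) ≤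
      6 * 1 + 6 * (eA I U : ℝ) + 5 * (volL I U : ℝ) + (eLA I U : ℝ) := by exact_mod_cast hK
  have hA' : (volL I U : ℝ) + volA I U ≤ 1 + 2 * (eL I U : ℝ) + eA I U + 2 * (eLA I U : ℝ) := by exact_mod_cast hA
  by_cases hreg : 10 * (U.card : ℝ) ≤ 3 * n
  · -- small `U`: bound (A); the quadratic terms are at most `(3/10)·C·|U|`
    have hQ : (m : ℝ) / n ^ 2 * (U.card : ℝ) ^ 2 ≤ 3 / 10 * ((m : ℝ) / n) * U.card := by
      have hn0 : (n : ℝ) ≠ 0 := hn'.ne'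
      have h1 : (m : ℝ) / n ^ 2 * (U.card : ℝ) ^ 2 = ((m : ℝ) / n * U.card) * ((U.card : ℝ) / n) := by
        field_simp
      have h2 : (U.card : ℝ) / n ≤ 3 / 10 := by
        rw [div_le_iff₀ hn']; linarith
      have h3 : (0 : ℝ) ≤ (m : ℝ) / n * U.card := by positivity
      rw [h1]
      calc (m : ℝ) / n * U.card * ((U.card : ℝ) / n) ≤ (m : ℝ) / n * U.card * (3 / 10) :=
            mul_le_mul_of_nonneg_left h2 h3
        _ = 3 / 10 * ((m : ℝ) / n) * U.card := by ring
    -- `1 ≥ (31/50·C − 14·s)·|U|`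
    have hb : (31 / 50 * ((m : ℝ) / n) - 14 * s) * U.card ≤ 1 := by linarith [hocc, heLhi, heA, heLA, hA', hQ]
    have hpos : (2 : ℝ) ≤ 31 / 50 * ((m : ℝ) / n) - 14 * s := by
      rw [← hs_sq]; linarith [hss, hs40]
    have hmono : (31 / 50 * ((m : ℝ) / n) - 14 * s) * 1 ≤ (31 / 50 * ((m : ℝ) / n) - 14 * s) * U.card :=
      mul_le_mul_of_nonneg_left hu (by linarith)
    linarith
  · -- large `U`: K1; the global imbalance is at most `(20/3)·s·|U|`
    have hlt : 3 * (n : ℝ) < 10 * U.card := by linarith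
    have hsn : (3 * n) * s ≤ (10 * U.card) * s := mul_le_mul_of_nonneg_right hlt.le hs0
    -- `6 ≥ (49/25·C − 218/3·s)·|U|`
    have hb : (49 / 25 * ((m : ℝ) / n) - 218 / 3 * s) * U.card ≤ 6 := by
      linarith [hocc, himb, heLlo, heA, heLA, hK', hsn]
    have hpos : (7 : ℝ) ≤ 49 / 25 * ((m : ℝ) / n) - 218 / 3 * s := by
      rw [← hs_sq]; linarith [hss, hs40]
    have hmono : (49 / 25 * ((m : ℝ) / n) - 218 / 3 * s) * 1 ≤ (49 / 25 * ((m : ℝ) / n) - 218 / 3 * s) * U.card :=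
      mul_le_mul_of_nonneg_left hu (by linarith)
    linarith

/-! ## The robust FP rung -/

/-- The robust structural promise: pure `P⋆` and `PseudoRandomW (1/50) 2 2`. -/
def PseudoRandomWPstar : ∀ ⦃n m : ℕ⦄, LocalMap 4 n m → Prop :=
  fun _ _ I => I.IsPure xorAndPred ∧ PseudoRandomW (1 / 50) 2 2 I

/-- **Rung F-N3(ψ), robust form**: range avoidance at linear stretch `m ≥ 1600 n` is in FP — by the avoider `isoStr` — for
the pure `P⋆` maps satisfying `PseudoRandomW (1/50) 2 2` (covers random slot-regular instances).  Restricted-model rung of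
the range-avoidance ladder (cell pnp-ideate, ROUND-19); it says nothing about `P` versus `NP`. -/
theorem pstarPseudoRandomW_localAvoidLinearFP : LocalAvoidLinearFP 4 PseudoRandomWPstar := by
  refine ⟨1600, isoStr, isPolyTime_isoStr, fun n m I hQ hn hm => ?_⟩
  have hm0 : 0 < m := lt_of_lt_of_le (by omega) hm
  rw [readOut_isoStr I hm0]
  exact allOnesIsolated_of_pseudoRandomW I hQ.1 hQ.2 hn hm ⟨0, hm0⟩

end Summit.PneNP.PneNP.Theorems.PstarIsolationRobust
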